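import Summits.CriticalPhenomena.PercolationContinuityZ3.Theorems.PercNearOneGluingNoHeavyLowerTailSunflowerCappedPendant
import HarnessLib

/-!
# `NoHeavyLowerTail` (crux stmt-CriticalPhenomena-4575), abstract sunflower cubic: the ONE-ALLOWANCE ENDGAME of the capped
# pendant lemma (the algebraic final step for `CappedPendant` when the `u`-heavy class carries at most one unit of leverage)

Support file (seat `prim-ineq-prove-1` gen 61; `--supports stmt-CriticalPhenomena-4575`).  No `sorry`, no named facts.
Memo: run/shared/lean/prim/prim-ineq-prove-1/FINDING-CPL-prove1-g61.md §4–§5.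

SETTING (`…SunflowerCappedPendant`, `…SunflowerPendantAnalytic`).  Normalised capped-pendant coordinates: `x = u/b`, `y = g/a₀`
(`g = (1−s)m + s·vv`, `a₀ = (1−s)b + sβ`), `z = vv/β`; each petal's value is `ψ(x,y) = pfun σ τ ρ x y` with `σ = st`, `τ = t(1−s)b`,
`ρ = (1−t)a₀`; budgets `b∏x ≤ 1`, `a₀∏y ≤ V`, `β∏z ≤ V`; link (L1, from `m ≤ u`) `a₀y ≤ (1−s)bx + sβz`; link (L2, from `m ≤ vv`)
`a₀y ≤ βz`.  Petals split into the `u`-heavy class `P` (`y ≤ x`) and the `g`-heavy class `Q` (`x < y`); both classes merge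
(`prod_pfun_le_merged`, and L1 link-merges within `Q` by `prod_lfun_le`).  NUMERICAL FACT (memo §4): the merged two-class endgame
is FALSE by `O(st)` in general (the merged `P` pretends to `g`-excess it cannot realise), but it HOLDS — supremum exactly `1` in every
test — as soon as the merged `u`-heavy class satisfies the single-petal link L2, `a₀Y_P ≤ βZ_P` ("one allowance"), e.g. whenever
at most one petal of the family has `m_j > b` (free `g`).  This file proves that endgame:

`one_allowance_final`: for `1 ≤ X ≤ Y`, `X ≤ Z`, `1 ≤ X_P`, budgets `b·X_P·X ≤ 1`, `a₀·Y_P·Z ≤ V` (= L2 for `P` combined with the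
`z`-budget), `βZ ≤ V`, and the link `a₀Y ≤ (1−s)bX + sβZ` for `Q`:  `ψ(X_P,Y_P)·ψ(X,Y) ≤ ψ(1,1)·(t + (1−t)V)`.
PROOF: monotonicity puts `P` at `(X₁,Y₁) = (1/(bX), V/(a₀Z))`; then the EXACT identity `oae_identity` (`linear_combination`)
`ψ(1,1)(t+(1−t)V) − ψ(X₁,Y₁)ψ(X,Y) = (Z−X)(1−t)[a₀Y₁(st+(1−s)b) − tsβ(s+(1−s)bX₁)] + Δ(1−t)[ρY₁ + τX₁ + st]
  + st·τ(X₁−1)(X−1) + st·ρ(Y₁−1)(X−1)`, `Δ := (1−s)bX + sβZ − a₀Y ≥ 0` the link slack, every bracket nonnegative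
(the first because `a₀Y₁ ≥ β` and `bX₁ ≤ 1`).  The successor's assembly (memo §5) turns this into the capped pendant lemma — hence
(RES0′) for all `n` — for every family with at most one free-`g` petal.
-/

noncomputable section

namespace Summit.CriticalPhenomena.PercolationContinuityZ3.Theorems.SunflowerPartition

namespace SafeCalc

namespace LinkedCurrency

open Finset Pendant

set_option maxHeartbeats 400000 in
/-- **The one-allowance identity.**  With `X₁·(bX) = 1` and `Y₁·(a₀Z) = V`:
`ψ(1,1)(t + (1−t)V) − ψ(X₁,Y₁)ψ(X,Y) = (Z−X)(1−t)[a₀Y₁(st+(1−s)b) − tsβ(s+(1−s)bX₁)]`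
`+ ((1−s)bX + sβZ − a₀Y)(1−t)[ρY₁ + τX₁ + st] + st·τ(X₁−1)(X−1) + st·ρ(Y₁−1)(X−1)`
(`σ, τ, ρ = st, t(1−s)b, (1−t)a₀`). [this work] -/
theorem oae_identity {s t b β V X Y Z X₁ Y₁ : ℝ} (hX₁ : X₁ * (b * X) = 1)
    (hY₁ : Y₁ * (((1 - s) * b + s * β) * Z) = V) :
    pfun (s * t) (t * (1 - s) * b) ((1 - t) * ((1 - s) * b + s * β)) 1 1 * (t + (1 - t) * V) -
        pfun (s * t) (t * (1 - s) * b) ((1 - t) * ((1 - s) * b + s * β)) X₁ Y₁ *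
          pfun (s * t) (t * (1 - s) * b) ((1 - t) * ((1 - s) * b + s * β)) X Y =
      (Z - X) * (1 - t) * (((1 - s) * b + s * β) * Y₁ * (s * t + (1 - s) * b) - t * s * β * (s + (1 - s) * b * X₁)) +
      ((1 - s) * b * X + s * β * Z - ((1 - s) * b + s * β) * Y) * (1 - t) *
        (Y₁ * ((1 - t) * ((1 - s) * b + s * β)) + t * (1 - s) * b * X₁ + s * t) +
      s * t * (t * (1 - s) * b) * ((X₁ - 1) * (X - 1)) +
      s * t * ((1 - t) * ((1 - s) * b + s * β)) * ((Y₁ - 1) * (X - 1)) := by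
  unfold pfun
  linear_combination (-(t * (1 - s) * (s * t + (1 - s) * b + (1 - t) * s * β))) * hX₁ +
    (-((1 - t) * (s * t + (1 - s) * b + (1 - t) * s * β))) * hY₁

/-- **The one-allowance endgame** (see the module docstring).  Parameters `0 < b ≤ β`, `s, t ∈ [0,1]`, cap `V`; a merged
`u`-heavy petal `(X_P, Y_P)` and a merged `g`-heavy petal `(X, Y)` with `z`-usage `Z`, `1 ≤ X ≤ Y`, `X ≤ Z`, `1 ≤ X_P`,
budgets `b X_P X ≤ 1`, `a₀ Y_P Z ≤ V`, `β Z ≤ V` and the link `a₀ Y ≤ (1−s) b X + s β Z`.  Then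
`ψ(X_P,Y_P)·ψ(X,Y) ≤ ψ(1,1)·(t + (1−t)V)`. [this work] -/
theorem one_allowance_final {b β s t V XP YP X Y Z : ℝ} (hb : 0 < b) (hbβ : b ≤ β) (hs : 0 ≤ s) (hs1 : s ≤ 1)
    (ht : 0 ≤ t) (ht1 : t ≤ 1) (hXP : 1 ≤ XP) (hX : 1 ≤ X) (hXY : X ≤ Y) (hXZ : X ≤ Z)
    (hbX : b * (XP * X) ≤ 1) (haY : ((1 - s) * b + s * β) * (YP * Z) ≤ V) (hβZ : β * Z ≤ V)
    (hlink : ((1 - s) * b + s * β) * Y ≤ (1 - s) * b * X + s * β * Z) :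
    pfun (s * t) (t * (1 - s) * b) ((1 - t) * ((1 - s) * b + s * β)) XP YP *
        pfun (s * t) (t * (1 - s) * b) ((1 - t) * ((1 - s) * b + s * β)) X Y ≤
      pfun (s * t) (t * (1 - s) * b) ((1 - t) * ((1 - s) * b + s * β)) 1 1 * (t + (1 - t) * V) := by
  have hs' : 0 ≤ 1 - s := sub_nonneg.2 hs1
  have ht' : 0 ≤ 1 - t := sub_nonneg.2 ht1
  have hβ : 0 < β := hb.trans_le hbβ
  have ha₀b : b ≤ (1 - s) * b + s * β := by nlinarith [mul_le_mul_of_nonneg_left hbβ hs]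
  have ha₀β : (1 - s) * b + s * β ≤ β := by nlinarith [mul_le_mul_of_nonneg_left hbβ hs']
  have ha₀ : 0 < (1 - s) * b + s * β := hb.trans_le ha₀b
  have hXpos : 0 < X := zero_lt_one.trans_le hX
  have hZ1 : 1 ≤ Z := hX.trans hXZ
  have hZpos : 0 < Z := zero_lt_one.trans_le hZ1
  have hτ0 : 0 ≤ t * (1 - s) * b := mul_nonneg (mul_nonneg ht hs') hb.le
  have hρ0 : 0 ≤ (1 - t) * ((1 - s) * b + s * β) := mul_nonneg ht' ha₀.le
  have hσ0 : 0 ≤ s * t := mul_nonneg hs ht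
  -- the extreme `u`-heavy petal `(X₁, Y₁) = (1/(bX), V/(a₀Z))`
  have hbXpos : 0 < b * X := mul_pos hb hXpos
  have haZpos : 0 < ((1 - s) * b + s * β) * Z := mul_pos ha₀ hZpos
  set X₁ : ℝ := 1 / (b * X) with hX₁
  set Y₁ : ℝ := V / (((1 - s) * b + s * β) * Z) with hY₁
  have hX₁def : X₁ * (b * X) = 1 := by rw [hX₁]; field_simp
  have hY₁def : Y₁ * (((1 - s) * b + s * β) * Z) = V := by rw [hY₁]; field_simp
  have hXPle : XP ≤ X₁ := by
    rw [hX₁, le_div_iff₀ hbXpos]; linarith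
  have hYPle : YP ≤ Y₁ := by
    rw [hY₁, le_div_iff₀ haZpos]; linarith
  have hbX1 : b * X ≤ 1 := by
    have h1 : X ≤ XP * X := le_mul_of_one_le_left hXpos.le hXP
    have h2 : b * X ≤ b * (XP * X) := mul_le_mul_of_nonneg_left h1 hb.le
    linarith
  have hX₁1 : 1 ≤ X₁ := by
    rw [hX₁, le_div_iff₀ hbXpos]; linarith
  have hbX₁ : b * X₁ ≤ 1 := by
    have e : b * X₁ = 1 / X := by rw [hX₁]; field_simp
    rw [e, div_le_one hXpos]; exact hX
  have haY₁ : β ≤ ((1 - s) * b + s * β) * Y₁ := by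
    have e : ((1 - s) * b + s * β) * Y₁ = V / Z := by rw [hY₁]; field_simp
    rw [e, le_div_iff₀ hZpos]; exact hβZ
  have hY₁1 : 1 ≤ Y₁ := by
    have h1 : ((1 - s) * b + s * β) * 1 ≤ ((1 - s) * b + s * β) * Y₁ := by
      rw [mul_one]; exact ha₀β.trans haY₁
    exact le_of_mul_le_mul_left h1 ha₀
  -- monotonicity: replace `(XP, YP)` by `(X₁, Y₁)`
  have hQnn : 0 ≤ pfun (s * t) (t * (1 - s) * b) ((1 - t) * ((1 - s) * b + s * β)) X Y :=
    pfun_nonneg hσ0 hτ0 hρ0 hXpos.le (zero_le_one.trans (hX.trans hXY))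
  have hmono : pfun (s * t) (t * (1 - s) * b) ((1 - t) * ((1 - s) * b + s * β)) XP YP ≤
      pfun (s * t) (t * (1 - s) * b) ((1 - t) * ((1 - s) * b + s * β)) X₁ Y₁ := pfun_mono hτ0 hρ0 hXPle hYPle
  refine (mul_le_mul_of_nonneg_right hmono hQnn).trans ?_
  have hid := oae_identity (s := s) (t := t) (β := β) (Y := Y) hX₁def hY₁def
  -- nonnegativity of the four terms
  have hbr : 0 ≤ ((1 - s) * b + s * β) * Y₁ * (s * t + (1 - s) * b) - t * s * β * (s + (1 - s) * b * X₁) := by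
    have h1 : β * (s * t + (1 - s) * b) ≤ ((1 - s) * b + s * β) * Y₁ * (s * t + (1 - s) * b) :=
      mul_le_mul_of_nonneg_right haY₁ (add_nonneg hσ0 (mul_nonneg hs' hb.le))
    have h2 : (1 - s) * b * X₁ ≤ (1 - s) * 1 :=
      calc (1 - s) * b * X₁ = (1 - s) * (b * X₁) := by ring
        _ ≤ (1 - s) * 1 := mul_le_mul_of_nonneg_left hbX₁ hs'
    have hk : 0 ≤ t * s * β := mul_nonneg (mul_nonneg ht hs) hβ.le
    have h3 : t * s * β * (s + (1 - s) * b * X₁) ≤ t * s * β * (s + (1 - s) * 1) :=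
      mul_le_mul_of_nonneg_left (by linarith) hk
    have h4 : β * (s * t + (1 - s) * b) - t * s * β * (s + (1 - s) * 1) = β * (1 - s) * b := by ring
    have h5 : 0 ≤ β * (1 - s) * b := mul_nonneg (mul_nonneg hβ.le hs') hb.le
    linarith
  have hT1 : 0 ≤ (Z - X) * (1 - t) *
      (((1 - s) * b + s * β) * Y₁ * (s * t + (1 - s) * b) - t * s * β * (s + (1 - s) * b * X₁)) :=
    mul_nonneg (mul_nonneg (sub_nonneg.2 hXZ) ht') hbr
  have hT2 : 0 ≤ ((1 - s) * b * X + s * β * Z - ((1 - s) * b + s * β) * Y) * (1 - t) *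
      (Y₁ * ((1 - t) * ((1 - s) * b + s * β)) + t * (1 - s) * b * X₁ + s * t) := by
    have h1 : 0 ≤ (1 - s) * b * X + s * β * Z - ((1 - s) * b + s * β) * Y := by linarith
    have h2 : 0 ≤ Y₁ * ((1 - t) * ((1 - s) * b + s * β)) + t * (1 - s) * b * X₁ + s * t :=
      add_nonneg (add_nonneg (mul_nonneg (zero_le_one.trans hY₁1) hρ0) (mul_nonneg hτ0 (zero_le_one.trans hX₁1))) hσ0
    exact mul_nonneg (mul_nonneg h1 ht') h2
  have hT3 : 0 ≤ s * t * (t * (1 - s) * b) * ((X₁ - 1) * (X - 1)) :=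
    mul_nonneg (mul_nonneg hσ0 hτ0) (mul_nonneg (sub_nonneg.2 hX₁1) (sub_nonneg.2 hX))
  have hT4 : 0 ≤ s * t * ((1 - t) * ((1 - s) * b + s * β)) * ((Y₁ - 1) * (X - 1)) :=
    mul_nonneg (mul_nonneg hσ0 hρ0) (mul_nonneg (sub_nonneg.2 hY₁1) (sub_nonneg.2 hX))
  linarith [hid, hT1, hT2, hT3, hT4]

end LinkedCurrency

end SafeCalc

end Summit.CriticalPhenomena.PercolationContinuityZ3.Theorems.SunflowerPartition
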